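import Summits.CriticalPhenomena.PercolationContinuityZ3.Theorems.PercNearOneGluingNoHeavyLowerTailQuantitativeAntitheticDeletionReduction
import HarnessLib

/-!
# The degree-two reduction of the antithetic size law to the EDGE-OBSERVER functional (BENCH row M2-R104, PROOFS §P70 (a)–(c))

Support file (`--supports stmt-CriticalPhenomena-4575`), prover seat `prim-rate-mine-2` (lane prim-rate, constants-miner (c);
`run/shared/lean/prim/prim-rate/prim-rate-mine-2/PROOFS.md` §P70).  No definitions, no named facts, no sorries; standard axioms.

SETTING (cube form, as in `…QuantitativeAntitheticDeletionReduction`).  `α` = all potential pairs, the graph is a pair set `P`, a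
2-colouring is `X ∩ P` (red) / `P \ X` (blue) for `X : Finset α`; `T F G : Finset α → ℤ` are the terminal readers of PROOFS §P68
(`T Y = [a ↔ x in Y]`, `F Y = [b ↔ x]`, `G Y = [u ↔ x]`) and the inflated antithetic functional is
`Φ(P) = Σ_X (T(X∩P) + T(P∖X) + C)(F(X∩P) − F(P∖X))(G(X∩P) − G(P∖X))`.
Here the weight vertex `a` has DEGREE TWO: its pairs are `e₁ ≠ e₂ ∈ P` (to the neighbours `w₁, w₂`), `D = {e₁, e₂}`, `P' = P ∖ D` is the
graph `H' = G − a`, and the readers of `G` are expressed through readers of `H'` and of `H'/f` (`f = w₁w₂` glued), all evaluated at `Y ∖ D`: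
`W₁, W₂` (= `[wᵢ ↔ x]` in `H'`), `Wf` (= `[w ↔ x]` in `H'/f`), `F₀, G₀` (in `H'`), `Ff, Gf` (in `H'/f`):
* both pairs of `a` red  ⇒ `T = Wf`, `F = Ff`, `G = Gf` (a red `w₁ – a – w₂` acts as the red pair `f`);
* exactly the pair `eᵢ` red ⇒ `T = Wᵢ`, `F = F₀`, `G = G₀` (`a` is a red leaf at `wᵢ`, it routes nothing);
* no pair of `a` red ⇒ `T = 0`, `F = F₀`, `G = G₀`.
These four clauses (hypotheses `hT`, `hF`, `hG`, for pair sets `Y ⊆ P`) are exactly the graph facts used; nothing else about graphs enters.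

* `CSH.antithetic_degTwo_identity` — **THE DEGREE-TWO IDENTITY (PROOFS §P70 (a), T120 of gen 26 in cube form)**:
  `4·Φ(P) = Σ_X ψ_RR + Σ_X ψ_BB + Σ_X ψ_RB + Σ_X ψ_BR`, the four colour classes of `a`'s two pairs, each written with the `H'`-readers at
  `Y = (X∩P)∖D`, `Y' = (P∖X)∖D`:  `ψ_RR = (Wf Y + C)(Ff Y − F₀ Y')(Gf Y − G₀ Y')` (the EDGE-OBSERVER = one-sided glued cross functional `Λ`),
  `ψ_BB` its mirror, `ψ_RB = (W₁ Y + W₂ Y' + C)(F₀ Y − F₀ Y')(G₀ Y − G₀ Y')`, `ψ_BR` likewise (proof: toggle `e₁`, `e₂` — two involutions of the cube).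
* `CSH.antithetic_degTwo_mirror` — `Σ_X ψ_BB = Σ_X ψ_RR` (complement involution).
* `CSH.antithetic_nonneg_of_degTwo` — **THEOREM (PROOFS §P70 (b)): if the edge-observer functional is `≥ 0` (conjecture (A½-edge), BENCH
  M2-R104: `Σ_X (Wf Y + C)(Ff Y − F₀ Y')(Gf Y − G₀ Y') ≥ 0`) and the two `(n−1)`-vertex functionals `Φ(H'; x,wᵢ,b,u) ≥ 0` (the induction
  hypothesis (A½) on fewer vertices), then `Φ(P) ≥ 0`** — (A½) for every graph whose weight vertex has degree two (all hub–path TOWERS, the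
  extremisers of the size law, and the 4-terminal near-towers), reduced to ONE one-sided inequality on the smaller graph.
[cite: VandenbergHaggstromKahn2005, Thm. 1.3 (p. 6)] [cite: Harris1960, Lemma 4.1 (p. 16)]
-/

namespace Summit.CriticalPhenomena.PercolationContinuityZ3.Theorems.CSH

open Finset
open scoped symmDiff

variable {α : Type*} [Fintype α] [DecidableEq α]

omit [Fintype α] in
/-- Toggling the colours of a fixed pair set is an involution of the cube. [cite: Harris1960, Lemma 4.1 (p. 16)] -/
theorem toggle_involutive (S : Finset α) : Function.Involutive (fun X : Finset α => X ∆ S) :=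
  fun X => symmDiff_symmDiff_cancel_right S X

/-- Reindexing a sum over the cube by a toggle. [cite: Harris1960, Lemma 4.1 (p. 16)] -/
theorem sum_toggle (S : Finset α) (g : Finset α → ℚ) :
    (∑ X : Finset α, g (X ∆ S)) = ∑ X : Finset α, g X :=
  Equiv.sum_comp (toggle_involutive S).toPerm g

omit [Fintype α] in
/-- Toggling pairs inside `D` does not change the red reading off `D`. [cite: Harris1960, Lemma 4.1 (p. 16)] -/
theorem inter_sdiff_toggle (X P S D : Finset α) (hS : S ⊆ D) :
    ((X ∆ S) ∩ P) \ D = (X ∩ P) \ D := by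
  ext y
  simp only [mem_sdiff, mem_inter, mem_symmDiff]
  constructor
  · rintro ⟨⟨h1, hP⟩, hD⟩
    rcases h1 with ⟨hX, -⟩ | ⟨hyS, -⟩
    · exact ⟨⟨hX, hP⟩, hD⟩
    · exact absurd (hS hyS) hD
  · rintro ⟨⟨hX, hP⟩, hD⟩
    exact ⟨⟨Or.inl ⟨hX, fun h => hD (hS h)⟩, hP⟩, hD⟩

omit [Fintype α] in
/-- Toggling pairs inside `D` does not change the blue reading off `D`. [cite: Harris1960, Lemma 4.1 (p. 16)] -/
theorem sdiff_toggle_sdiff (X P S D : Finset α) (hS : S ⊆ D) :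
    (P \ (X ∆ S)) \ D = (P \ X) \ D := by
  ext y
  simp only [mem_sdiff, mem_symmDiff, not_or, not_and, not_not]
  constructor
  · rintro ⟨⟨hP, h1, -⟩, hD⟩
    refine ⟨⟨hP, fun hX => hD (hS (h1 hX))⟩, hD⟩
  · rintro ⟨⟨hP, hX⟩, hD⟩
    exact ⟨⟨hP, fun h => absurd h hX, fun hyS => absurd (hS hyS) hD⟩, hD⟩

/-- **THE DEGREE-TWO IDENTITY** (PROOFS §P70 (a); gen-26 T120 in cube form): with the weight vertex `a` of degree two (pairs `e₁ ≠ e₂` of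
`P`, `D = {e₁,e₂}`) and the readers of `G` expressed through the readers `W₁ W₂ Wf F₀ G₀ Ff Gf` of `H' = G − a` and `H'/w₁w₂`
(hypotheses `hT hF hG`), four times the inflated antithetic functional of `P` is the sum of the four colour-class functionals
`ψ_RR + ψ_BB + ψ_RB + ψ_BR` written at `Y = (X∩P)∖D`, `Y' = (P∖X)∖D`. [cite: VandenbergHaggstromKahn2005, Thm. 1.3 (p. 6)] -/
theorem antithetic_degTwo_identity (T F G W₁ W₂ Wf F₀ G₀ Ff Gf : Finset α → ℤ) (P : Finset α) (e₁ e₂ : α) (C : ℚ)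
    (he : e₁ ≠ e₂) (he₁ : e₁ ∈ P) (he₂ : e₂ ∈ P)
    (hT : ∀ Y, Y ⊆ P → T Y = if e₁ ∈ Y then (if e₂ ∈ Y then Wf (Y \ {e₁, e₂}) else W₁ (Y \ {e₁, e₂}))
                          else (if e₂ ∈ Y then W₂ (Y \ {e₁, e₂}) else 0))
    (hF : ∀ Y, Y ⊆ P → F Y = if e₁ ∈ Y ∧ e₂ ∈ Y then Ff (Y \ {e₁, e₂}) else F₀ (Y \ {e₁, e₂}))
    (hG : ∀ Y, Y ⊆ P → G Y = if e₁ ∈ Y ∧ e₂ ∈ Y then Gf (Y \ {e₁, e₂}) else G₀ (Y \ {e₁, e₂})) :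
    4 * (∑ X : Finset α, ((T (X ∩ P) : ℚ) + (T (P \ X) : ℚ) + C) *
        (((F (X ∩ P) : ℚ) - (F (P \ X) : ℚ)) * ((G (X ∩ P) : ℚ) - (G (P \ X) : ℚ))))
    = (∑ X : Finset α, ((Wf ((X ∩ P) \ {e₁, e₂}) : ℚ) + C) *
          (((Ff ((X ∩ P) \ {e₁, e₂}) : ℚ) - (F₀ ((P \ X) \ {e₁, e₂}) : ℚ)) *
           ((Gf ((X ∩ P) \ {e₁, e₂}) : ℚ) - (G₀ ((P \ X) \ {e₁, e₂}) : ℚ))))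
      + (∑ X : Finset α, ((Wf ((P \ X) \ {e₁, e₂}) : ℚ) + C) *
          (((F₀ ((X ∩ P) \ {e₁, e₂}) : ℚ) - (Ff ((P \ X) \ {e₁, e₂}) : ℚ)) *
           ((G₀ ((X ∩ P) \ {e₁, e₂}) : ℚ) - (Gf ((P \ X) \ {e₁, e₂}) : ℚ))))
      + (∑ X : Finset α, ((W₁ ((X ∩ P) \ {e₁, e₂}) : ℚ) + (W₂ ((P \ X) \ {e₁, e₂}) : ℚ) + C) *
          (((F₀ ((X ∩ P) \ {e₁, e₂}) : ℚ) - (F₀ ((P \ X) \ {e₁, e₂}) : ℚ)) *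
           ((G₀ ((X ∩ P) \ {e₁, e₂}) : ℚ) - (G₀ ((P \ X) \ {e₁, e₂}) : ℚ))))
      + (∑ X : Finset α, ((W₂ ((X ∩ P) \ {e₁, e₂}) : ℚ) + (W₁ ((P \ X) \ {e₁, e₂}) : ℚ) + C) *
          (((F₀ ((X ∩ P) \ {e₁, e₂}) : ℚ) - (F₀ ((P \ X) \ {e₁, e₂}) : ℚ)) *
           ((G₀ ((X ∩ P) \ {e₁, e₂}) : ℚ) - (G₀ ((P \ X) \ {e₁, e₂}) : ℚ)))) := by
  -- abbreviations
  set D : Finset α := {e₁, e₂} with hD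
  set Ψ : Finset α → ℚ := fun X => ((T (X ∩ P) : ℚ) + (T (P \ X) : ℚ) + C) *
        (((F (X ∩ P) : ℚ) - (F (P \ X) : ℚ)) * ((G (X ∩ P) : ℚ) - (G (P \ X) : ℚ))) with hΨ
  have hS1 : ({e₁} : Finset α) ⊆ D := by simp [hD]
  have hS2 : ({e₂} : Finset α) ⊆ D := by simp [hD]
  have hSD : D ⊆ D := subset_rfl
  -- the four toggled copies of the sum are all equal to the sum
  have h4 : 4 * (∑ X : Finset α, Ψ X)
      = ∑ X : Finset α, (Ψ X + Ψ (X ∆ {e₁}) + Ψ (X ∆ {e₂}) + Ψ (X ∆ D)) := by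
    rw [Finset.sum_add_distrib, Finset.sum_add_distrib, Finset.sum_add_distrib,
      sum_toggle {e₁} Ψ, sum_toggle {e₂} Ψ, sum_toggle D Ψ]
    ring
  rw [h4, ← Finset.sum_add_distrib, ← Finset.sum_add_distrib, ← Finset.sum_add_distrib]
  refine Finset.sum_congr rfl fun X _ => ?_
  -- evaluation of the G-readers on a colouring V in terms of the memberships of e₁, e₂ in V
  have evT : ∀ V : Finset α, (T (V ∩ P) : ℚ)
      = if e₁ ∈ V then (if e₂ ∈ V then (Wf ((V ∩ P) \ D) : ℚ) else (W₁ ((V ∩ P) \ D) : ℚ))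
        else (if e₂ ∈ V then (W₂ ((V ∩ P) \ D) : ℚ) else 0) := fun V => by
    rw [hT (V ∩ P) inter_subset_right]
    have m1 : e₁ ∈ V ∩ P ↔ e₁ ∈ V := by simp [he₁]
    have m2 : e₂ ∈ V ∩ P ↔ e₂ ∈ V := by simp [he₂]
    simp only [m1, m2]
    split_ifs <;> simp
  have evT' : ∀ V : Finset α, (T (P \ V) : ℚ)
      = if e₁ ∉ V then (if e₂ ∉ V then (Wf ((P \ V) \ D) : ℚ) else (W₁ ((P \ V) \ D) : ℚ))
        else (if e₂ ∉ V then (W₂ ((P \ V) \ D) : ℚ) else 0) := fun V => by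
    rw [hT (P \ V) sdiff_subset]
    have m1 : e₁ ∈ P \ V ↔ e₁ ∉ V := by simp [he₁]
    have m2 : e₂ ∈ P \ V ↔ e₂ ∉ V := by simp [he₂]
    simp only [m1, m2]
    split_ifs <;> simp
  have evF : ∀ V : Finset α, (F (V ∩ P) : ℚ)
      = if e₁ ∈ V ∧ e₂ ∈ V then (Ff ((V ∩ P) \ D) : ℚ) else (F₀ ((V ∩ P) \ D) : ℚ) := fun V => by
    rw [hF (V ∩ P) inter_subset_right]
    have m1 : e₁ ∈ V ∩ P ↔ e₁ ∈ V := by simp [he₁]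
    have m2 : e₂ ∈ V ∩ P ↔ e₂ ∈ V := by simp [he₂]
    simp only [m1, m2]
    split_ifs <;> simp
  have evF' : ∀ V : Finset α, (F (P \ V) : ℚ)
      = if e₁ ∉ V ∧ e₂ ∉ V then (Ff ((P \ V) \ D) : ℚ) else (F₀ ((P \ V) \ D) : ℚ) := fun V => by
    rw [hF (P \ V) sdiff_subset]
    have m1 : e₁ ∈ P \ V ↔ e₁ ∉ V := by simp [he₁]
    have m2 : e₂ ∈ P \ V ↔ e₂ ∉ V := by simp [he₂]
    simp only [m1, m2]
    split_ifs <;> simp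
  have evG : ∀ V : Finset α, (G (V ∩ P) : ℚ)
      = if e₁ ∈ V ∧ e₂ ∈ V then (Gf ((V ∩ P) \ D) : ℚ) else (G₀ ((V ∩ P) \ D) : ℚ) := fun V => by
    rw [hG (V ∩ P) inter_subset_right]
    have m1 : e₁ ∈ V ∩ P ↔ e₁ ∈ V := by simp [he₁]
    have m2 : e₂ ∈ V ∩ P ↔ e₂ ∈ V := by simp [he₂]
    simp only [m1, m2]
    split_ifs <;> simp
  have evG' : ∀ V : Finset α, (G (P \ V) : ℚ)
      = if e₁ ∉ V ∧ e₂ ∉ V then (Gf ((P \ V) \ D) : ℚ) else (G₀ ((P \ V) \ D) : ℚ) := fun V => by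
    rw [hG (P \ V) sdiff_subset]
    have m1 : e₁ ∈ P \ V ↔ e₁ ∉ V := by simp [he₁]
    have m2 : e₂ ∈ P \ V ↔ e₂ ∉ V := by simp [he₂]
    simp only [m1, m2]
    split_ifs <;> simp
  -- the readings off D are toggle-invariant
  have r1 : ((X ∆ {e₁}) ∩ P) \ D = (X ∩ P) \ D := inter_sdiff_toggle X P {e₁} D hS1
  have r2 : ((X ∆ {e₂}) ∩ P) \ D = (X ∩ P) \ D := inter_sdiff_toggle X P {e₂} D hS2
  have r3 : ((X ∆ D) ∩ P) \ D = (X ∩ P) \ D := inter_sdiff_toggle X P D D hSD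
  have b1 : (P \ (X ∆ {e₁})) \ D = (P \ X) \ D := sdiff_toggle_sdiff X P {e₁} D hS1
  have b2 : (P \ (X ∆ {e₂})) \ D = (P \ X) \ D := sdiff_toggle_sdiff X P {e₂} D hS2
  have b3 : (P \ (X ∆ D)) \ D = (P \ X) \ D := sdiff_toggle_sdiff X P D D hSD
  -- memberships after toggling
  have n11 : e₁ ∈ X ∆ {e₁} ↔ e₁ ∉ X := by simp [mem_symmDiff]
  have n21 : e₂ ∈ X ∆ {e₁} ↔ e₂ ∈ X := by simp [mem_symmDiff, he.symm]
  have n12 : e₁ ∈ X ∆ {e₂} ↔ e₁ ∈ X := by simp [mem_symmDiff, he]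
  have n22 : e₂ ∈ X ∆ {e₂} ↔ e₂ ∉ X := by simp [mem_symmDiff]
  have n1D : e₁ ∈ X ∆ D ↔ e₁ ∉ X := by simp [mem_symmDiff, hD]
  have n2D : e₂ ∈ X ∆ D ↔ e₂ ∉ X := by simp [mem_symmDiff, hD, he.symm]
  -- expand everything
  simp only [hΨ]
  rw [evT X, evT' X, evF X, evF' X, evG X, evG' X,
    evT (X ∆ {e₁}), evT' (X ∆ {e₁}), evF (X ∆ {e₁}), evF' (X ∆ {e₁}), evG (X ∆ {e₁}), evG' (X ∆ {e₁}),
    evT (X ∆ {e₂}), evT' (X ∆ {e₂}), evF (X ∆ {e₂}), evF' (X ∆ {e₂}), evG (X ∆ {e₂}), evG' (X ∆ {e₂}),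
    evT (X ∆ D), evT' (X ∆ D), evF (X ∆ D), evF' (X ∆ D), evG (X ∆ D), evG' (X ∆ D),
    r1, r2, r3, b1, b2, b3]
  simp only [n11, n21, n12, n22, n1D, n2D]
  by_cases h1 : e₁ ∈ X <;> by_cases h2 : e₂ ∈ X <;> simp [h1, h2] <;> ring

/-- **Mirror symmetry of the two monochromatic classes**: `Σ_X ψ_BB = Σ_X ψ_RR` (the complement involution `X ↦ Xᶜ` swaps the red
reading `(X∩P)∖D` and the blue reading `(P∖X)∖D`). [cite: Harris1960, Lemma 4.1 (p. 16)] -/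
theorem antithetic_degTwo_mirror (Wf F₀ G₀ Ff Gf : Finset α → ℤ) (P D : Finset α) (C : ℚ) :
    (∑ X : Finset α, ((Wf ((P \ X) \ D) : ℚ) + C) *
          (((F₀ ((X ∩ P) \ D) : ℚ) - (Ff ((P \ X) \ D) : ℚ)) * ((G₀ ((X ∩ P) \ D) : ℚ) - (Gf ((P \ X) \ D) : ℚ))))
    = ∑ X : Finset α, ((Wf ((X ∩ P) \ D) : ℚ) + C) *
          (((Ff ((X ∩ P) \ D) : ℚ) - (F₀ ((P \ X) \ D) : ℚ)) * ((Gf ((X ∩ P) \ D) : ℚ) - (G₀ ((P \ X) \ D) : ℚ))) := by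
  have hinv : Function.Involutive (compl : Finset α → Finset α) := compl_involutive
  rw [← Equiv.sum_comp hinv.toPerm]
  refine Finset.sum_congr rfl fun X _ => ?_
  have h1 : Xᶜ ∩ P = P \ X := by ext y; simp [mem_inter, and_comm]
  have h2 : P \ Xᶜ = X ∩ P := by ext y; simp [mem_inter, and_comm]
  simp only [Function.Involutive.coe_toPerm, h1, h2]
  ring

/-- **THEOREM (THE DEGREE-TWO REDUCTION, PROOFS §P70 (b); BENCH M2-R104).**  Weight vertex `a` of degree two (pairs `e₁ ≠ e₂` of `P`;
readers of `G` given by `hT hF hG` through the readers of `H' = G − a` and `H'/w₁w₂`).  IF the EDGE-OBSERVER functional of `H' + w₁w₂` is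
non-negative — `0 ≤ Σ_X (Wf Y + C)(Ff Y − F₀ Y')(Gf Y − G₀ Y')`, conjecture (A½-edge) (one-sided: glued reading on the red side only, weight
on the red side only; 0 violations in the complete census n ≤ 7 and on all 8-vertex graphs with ≤ 13 pairs) — and the two antithetic functionals of the SMALLER graph
`H'` with `a` replaced by `w₁` resp. `w₂` are non-negative (the induction hypothesis (A½) on `n − 1` vertices, `C(n−1) ≤ C(n)`), THEN
`Φ(P) ≥ 0`: (A½), hence the size law (S1), for every graph whose weight vertex has degree two — the hub–path towers (the extremisers) and
the 4-terminal near-towers included. [cite: VandenbergHaggstromKahn2005, Thm. 1.3 (p. 6)] [cite: Harris1960, Lemma 4.1 (p. 16)] -/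
theorem antithetic_nonneg_of_degTwo (T F G W₁ W₂ Wf F₀ G₀ Ff Gf : Finset α → ℤ) (P : Finset α) (e₁ e₂ : α) (C : ℚ)
    (he : e₁ ≠ e₂) (he₁ : e₁ ∈ P) (he₂ : e₂ ∈ P)
    (hT : ∀ Y, Y ⊆ P → T Y = if e₁ ∈ Y then (if e₂ ∈ Y then Wf (Y \ {e₁, e₂}) else W₁ (Y \ {e₁, e₂}))
                          else (if e₂ ∈ Y then W₂ (Y \ {e₁, e₂}) else 0))
    (hF : ∀ Y, Y ⊆ P → F Y = if e₁ ∈ Y ∧ e₂ ∈ Y then Ff (Y \ {e₁, e₂}) else F₀ (Y \ {e₁, e₂}))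
    (hG : ∀ Y, Y ⊆ P → G Y = if e₁ ∈ Y ∧ e₂ ∈ Y then Gf (Y \ {e₁, e₂}) else G₀ (Y \ {e₁, e₂}))
    (hΛ : 0 ≤ ∑ X : Finset α, ((Wf ((X ∩ P) \ {e₁, e₂}) : ℚ) + C) *
          (((Ff ((X ∩ P) \ {e₁, e₂}) : ℚ) - (F₀ ((P \ X) \ {e₁, e₂}) : ℚ)) *
           ((Gf ((X ∩ P) \ {e₁, e₂}) : ℚ) - (G₀ ((P \ X) \ {e₁, e₂}) : ℚ))))
    (h₁ : 0 ≤ ∑ X : Finset α, ((W₁ ((X ∩ P) \ {e₁, e₂}) : ℚ) + (W₁ ((P \ X) \ {e₁, e₂}) : ℚ) + C) *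
          (((F₀ ((X ∩ P) \ {e₁, e₂}) : ℚ) - (F₀ ((P \ X) \ {e₁, e₂}) : ℚ)) *
           ((G₀ ((X ∩ P) \ {e₁, e₂}) : ℚ) - (G₀ ((P \ X) \ {e₁, e₂}) : ℚ))))
    (h₂ : 0 ≤ ∑ X : Finset α, ((W₂ ((X ∩ P) \ {e₁, e₂}) : ℚ) + (W₂ ((P \ X) \ {e₁, e₂}) : ℚ) + C) *
          (((F₀ ((X ∩ P) \ {e₁, e₂}) : ℚ) - (F₀ ((P \ X) \ {e₁, e₂}) : ℚ)) *
           ((G₀ ((X ∩ P) \ {e₁, e₂}) : ℚ) - (G₀ ((P \ X) \ {e₁, e₂}) : ℚ)))) :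
    0 ≤ ∑ X : Finset α, ((T (X ∩ P) : ℚ) + (T (P \ X) : ℚ) + C) *
        (((F (X ∩ P) : ℚ) - (F (P \ X) : ℚ)) * ((G (X ∩ P) : ℚ) - (G (P \ X) : ℚ))) := by
  have hid := antithetic_degTwo_identity T F G W₁ W₂ Wf F₀ G₀ Ff Gf P e₁ e₂ C he he₁ he₂ hT hF hG
  have hmir := antithetic_degTwo_mirror Wf F₀ G₀ Ff Gf P {e₁, e₂} C
  -- the two mixed classes regroup into the two (n−1)-vertex functionals
  have hmix : (∑ X : Finset α, ((W₁ ((X ∩ P) \ {e₁, e₂}) : ℚ) + (W₂ ((P \ X) \ {e₁, e₂}) : ℚ) + C) *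
          (((F₀ ((X ∩ P) \ {e₁, e₂}) : ℚ) - (F₀ ((P \ X) \ {e₁, e₂}) : ℚ)) *
           ((G₀ ((X ∩ P) \ {e₁, e₂}) : ℚ) - (G₀ ((P \ X) \ {e₁, e₂}) : ℚ))))
      + (∑ X : Finset α, ((W₂ ((X ∩ P) \ {e₁, e₂}) : ℚ) + (W₁ ((P \ X) \ {e₁, e₂}) : ℚ) + C) *
          (((F₀ ((X ∩ P) \ {e₁, e₂}) : ℚ) - (F₀ ((P \ X) \ {e₁, e₂}) : ℚ)) *
           ((G₀ ((X ∩ P) \ {e₁, e₂}) : ℚ) - (G₀ ((P \ X) \ {e₁, e₂}) : ℚ))))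
      = (∑ X : Finset α, ((W₁ ((X ∩ P) \ {e₁, e₂}) : ℚ) + (W₁ ((P \ X) \ {e₁, e₂}) : ℚ) + C) *
          (((F₀ ((X ∩ P) \ {e₁, e₂}) : ℚ) - (F₀ ((P \ X) \ {e₁, e₂}) : ℚ)) *
           ((G₀ ((X ∩ P) \ {e₁, e₂}) : ℚ) - (G₀ ((P \ X) \ {e₁, e₂}) : ℚ))))
      + (∑ X : Finset α, ((W₂ ((X ∩ P) \ {e₁, e₂}) : ℚ) + (W₂ ((P \ X) \ {e₁, e₂}) : ℚ) + C) *
          (((F₀ ((X ∩ P) \ {e₁, e₂}) : ℚ) - (F₀ ((P \ X) \ {e₁, e₂}) : ℚ)) *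
           ((G₀ ((X ∩ P) \ {e₁, e₂}) : ℚ) - (G₀ ((P \ X) \ {e₁, e₂}) : ℚ)))) := by
    rw [← Finset.sum_add_distrib, ← Finset.sum_add_distrib]
    refine Finset.sum_congr rfl fun X _ => ?_
    ring
  have h4 : 0 ≤ 4 * (∑ X : Finset α, ((T (X ∩ P) : ℚ) + (T (P \ X) : ℚ) + C) *
        (((F (X ∩ P) : ℚ) - (F (P \ X) : ℚ)) * ((G (X ∩ P) : ℚ) - (G (P \ X) : ℚ)))) := by
    rw [hid, hmir, add_assoc, hmix]
    linarith
  linarith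

end Summit.CriticalPhenomena.PercolationContinuityZ3.Theorems.CSH
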